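import Summits.ResolutionOfSingularities.ResolutionOfSingularities.Theorems.FrobeniusLadderFInjectiveMacaulayficationAssocGradedVertex
import Summits.ResolutionOfSingularities.ResolutionOfSingularities.Theorems.FrobeniusLadderFInjectiveMacaulayficationAssocGradedNoetherian
import HarnessLib

/-!
# ThmDSig §3d `cmfiCl_of_vertex` — VERTEX ⇒ EVERY PRIME of the cone `G(F)`, with the Veronese binder (Hashimoto bridge, assembled)
# (crux `FInjectiveMacaulayfication` stmt-ResolutionOfSingularities-15315, chain w45a, THEOREM-D programme (A1); res-L1-w45a-idea-1 `ThmDSig.lean`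
# r18.1 §3d signature; res-L1-w45a-plan-1 R16.8 (1) / R16.20; seat res-L1-w45a-stub-2)

[OURS · L1 W4.5a] Support file (`--supports stmt-ResolutionOfSingularities-15315 --as helper`); NOT a statement of any manuscript; CONDITIONAL on
Hashimoto 2010 Cor. 5.2 (spelled-out hypothesis `hH` = token text of the queued named fact `Hashimoto2010_cmfi_of_homogeneousCore` at universe 0)
and Cor. 4.7 (named fact `Literature.RingTheory.TightClosure.Hashimoto2010_cmfiLocalizes`); def-free; AI-written (AI review is weaker than expert review).

`cmfiCl_of_vertex (hH) (hL) p 𝒪 F (hV : ∃ N, 0 < N ∧ IsVeronese F N) (h𝔑) : ∀ 𝔓, CMCl ∧ FCl at 𝔓` — EXACTLY the §3d consumer shape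
(`VertexCond` unfolded), assembled from `AssocGradedVertex.cmfiCl_of_vertex_of_hashimoto` (vertex ⇒ primes, given `G(F)` Noetherian) and
`AssocGradedNoetherian.isNoetherianRing_assocGraded_of_exists_isVeronese` (`hV ⇒ G(F)` Noetherian). [cite: Hashimoto2010, Cor. 4.7; Cor. 5.2]
-/

-- single-problem summit: the doubled namespace component is forced
set_option linter.dupNamespace false

noncomputable section

namespace Summit.ResolutionOfSingularities.ResolutionOfSingularities.Theorems.FInjectiveMacaulayfication.CmfiClOfVertex

open IsLocalRing
open Summit.ResolutionOfSingularities.ResolutionOfSingularities.Theorems.FInjectiveMacaulayfication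
open GDD

/-- **§3d `cmfiCl_of_vertex` (A1): if `F` has a Veronese exponent and the CM clause and the F-clause hold at the vertex of `G(F)`, they hold at
EVERY prime of `G(F)[1/1̄·T⁰]`** — modulo Hashimoto 2010 Cor. 5.2 (`hH`) and Cor. 4.7 (`hL`) BY NAME. [OURS · conditional-result]
[cite: Hashimoto2010, Cor. 4.7; Cor. 5.2] -/
theorem cmfiCl_of_vertex
    (hH : ∀ (p : ℕ) [Fact p.Prime] (A : Type) [CommRing A] [IsNoetherianRing A] [CharP A p]
      (𝒜 : ℕ → AddSubgroup A) [GradedRing 𝒜] (P : Ideal A) [P.IsPrime] [(P.homogeneousCore 𝒜).toIdeal.IsPrime],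
      ((∀ d : ℕ, ringKrullDim (Localization.AtPrime (P.homogeneousCore 𝒜).toIdeal) = d →
          ∀ s : Fin d → Localization.AtPrime (P.homogeneousCore 𝒜).toIdeal, (Ideal.span (Set.range s)).radical.IsMaximal →
            RingTheory.Sequence.IsWeaklyRegular (Localization.AtPrime (P.homogeneousCore 𝒜).toIdeal) (List.ofFn s)) ∧
        (∀ d : ℕ, ringKrullDim (Localization.AtPrime (P.homogeneousCore 𝒜).toIdeal) = d →
          ∀ s : Fin d → Localization.AtPrime (P.homogeneousCore 𝒜).toIdeal, (Ideal.span (Set.range s)).radical.IsMaximal →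
            ∀ y : Localization.AtPrime (P.homogeneousCore 𝒜).toIdeal,
              (∃ e : ℕ, y ^ p ^ e ∈ Ideal.span ((fun z : Localization.AtPrime (P.homogeneousCore 𝒜).toIdeal => z ^ p ^ e) ''
                (Ideal.span (Set.range s) : Set (Localization.AtPrime (P.homogeneousCore 𝒜).toIdeal)))) →
              y ∈ Ideal.span (Set.range s))) →
      ((∀ d : ℕ, ringKrullDim (Localization.AtPrime P) = d →
          ∀ s : Fin d → Localization.AtPrime P, (Ideal.span (Set.range s)).radical.IsMaximal →
            RingTheory.Sequence.IsWeaklyRegular (Localization.AtPrime P) (List.ofFn s)) ∧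
        (∀ d : ℕ, ringKrullDim (Localization.AtPrime P) = d →
          ∀ s : Fin d → Localization.AtPrime P, (Ideal.span (Set.range s)).radical.IsMaximal →
            ∀ y : Localization.AtPrime P,
              (∃ e : ℕ, y ^ p ^ e ∈ Ideal.span ((fun z : Localization.AtPrime P => z ^ p ^ e) ''
                (Ideal.span (Set.range s) : Set (Localization.AtPrime P)))) →
              y ∈ Ideal.span (Set.range s))))
    (hL : Literature.RingTheory.TightClosure.Hashimoto2010_cmfiLocalizes.{0})
    (p : ℕ) [Fact p.Prime] (𝒪 : Type) [CommRing 𝒪] [IsNoetherianRing 𝒪] [IsLocalRing 𝒪] [CharP 𝒪 p]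
    (F : MultFiltration 𝒪) (hV : ∃ N, 0 < N ∧ IsVeronese F N)
    (h𝔑 : ∀ (𝔑 : Ideal (Localization.Away (homogBar F 0 1 (one_mem_I_zero 𝒪 F)))) [𝔑.IsMaximal],
      ((∀ x ∈ maximalIdeal 𝒪, algebraMap 𝒪 (Localization.Away (homogBar F 0 1 (one_mem_I_zero 𝒪 F))) x ∈ 𝔑) ∧
        ∀ (n : ℕ), 0 < n → ∀ (a : 𝒪) (ha : a ∈ F.I n),
          (OreLocalization.numeratorRingHom (homogBar F n a ha) : Localization.Away (homogBar F 0 1 (one_mem_I_zero 𝒪 F))) ∈ 𝔑) →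
      SliceableCentre.CMCl (Localization.AtPrime 𝔑) ∧ SliceableCentre.FCl p (Localization.AtPrime 𝔑)) :
    ∀ (𝔓 : Ideal (Localization.Away (homogBar F 0 1 (one_mem_I_zero 𝒪 F)))) [𝔓.IsPrime],
      SliceableCentre.CMCl (Localization.AtPrime 𝔓) ∧ SliceableCentre.FCl p (Localization.AtPrime 𝔓) :=
  AssocGradedVertex.cmfiCl_of_vertex_of_hashimoto hH hL p 𝒪 F
    (AssocGradedNoetherian.isNoetherianRing_assocGraded_of_exists_isVeronese F hV) h𝔑

end Summit.ResolutionOfSingularities.ResolutionOfSingularities.Theorems.FInjectiveMacaulayfication.CmfiClOfVertex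

end
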